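import Literature.IUT.LogThetaLattice.PacketLogVolumesHaarModelCapsulesGeneral
import HarnessLib

/-!
# [IUTchIII] Proposition 3.9 (i) for CAPSULES at the genuine adelic Haar model, X: at `v_ℚ = ∞` the capsule log-volume
# of a HULL region equals the log-volume of [IUTchIV] Prop. 1.5 (iii)'s single container `M_I = ⊗_{α,ℝ}(⊕_{w|∞} ℂ_w)`
# — the archimedean junction with abc-iut-L5-t7's / the Cor 3.12 crew's container, on all hull-sets, for totally
# complex `F` (abc-iut cell, layer L6; row CAP39 part X, abc-iut-L6-d3)

S. Mochizuki, *Inter-universal Teichmüller theory III*, kurims manuscript (May 2020), Proposition 3.9 (i), p. 116 (the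
archimedean log-volume on `𝓘^ℚ(^A𝓕_{v_ℚ})`, "normalized" weights of Remark 3.1.1 (ii)); Remark 3.9.5 (i) p. 127
(hull-sets = direct products of discs); *Inter-universal Teichmüller theory IV*, Proposition 1.5 (iii) p. 15 (`M_I :=
⊗_{i∈I} M_i`, `M = ⊕_{v∈V} ℂ_v`, its direct sum decomposition into copies of `ℂ` and the hermitian metric) and the
proof of Theorem 1.10, Step (vii), p. 30 ("the log-volume of `B_I` is equal to `0`"); [IUTchI] Definition 3.1 (a)
(`√−1 ∈ F`, so every archimedean place of `F` is complex). [claim: Mochizuki2012, status: disputed]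

TWO ARCHIMEDEAN CONTAINERS. (1) abc-iut-L5-t7's `M_I = Prop15iii.MI A W` (`W` = the archimedean places) with ONE
normalised log-volume `packetLogVol Φ₀ = nlogVol` in the coordinates `Idx A W = (A → W) × {±}^{A∖{α₀}}` of the canonical
decomposition (`B_I ↦ 0`, `×c ↦ +log|c|`) — the container of the Cor 3.12 crew at `∞` (abc-iut-c312's
`Cor312Vol.ArchPresentation.logμ`, w5-d163's `archPresentationDH`). (2) The row's genuine capsule model (p418604/p419250):
the PORTIONS `⊗_{α,ℝ} ℂ = MI A Unit`, one for each tuple `π = (w_α)_α` of archimedean places, each with its own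
normalised log-volume, averaged with the Remark 3.1.1 (ii) weights `portionWeight π = ∏_α [F_{w_α}:ℝ]/[F:ℚ]`
(`capsulePacketLogVolume F A ∞`). Since `M_I = ⊗_α ⊕_w ℂ_w ≅ ⊕_π ⊗_α ℂ_{w_α}`, the coordinates of (1) are the disjoint
union over `π` of the coordinates of the portions: `Idx A W = ⊔_π Idx A Unit`.

WHAT THIS FILE PROVES. For HULL regions — polydiscs in the coordinates, radius `r(π, ε) > 0` at the coordinate
`(π, ε)` ([IUTchIII] Rmk. 3.9.5: the regions the log-volume computations of Cor. 3.12 / [IUTchIV] Thm. 1.10 use at `∞`):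
* `packetLogVol_archHullRegion`: container (1) gives `(1/#(A→W))·Σ_π (1/#{±}')·Σ_ε log r(π,ε)` (L5-t7 `nlogVol_polydisc`);
* `archPortion_logVol_archHullPortionRegion`: the portion `π` of container (2) gives `(1/#{±}')·Σ_ε log r(π,ε)`;
* `portionWeight_infty_of_isComplex`: for TOTALLY COMPLEX `F` ([IUTchI] Def. 3.1 (a)) the Remark 3.1.1 (ii) weights at
  `∞` are UNIFORM, `portionWeight π = 1/#(A → W)` (`[F_w:ℝ] = 2` for every `w`, `[F:ℚ] = 2·#W`);
* hence **`capsulePacketLogVolume_infty_archHullFamily`**: `μ^log_{A,∞}` of the genuine capsule model (2) on the hull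
  family EQUALS the single-container log-volume (1) of the hull region — the archimedean counterpart of the prime-side
  junctions p421286 (Dupuy–Hilado recipe) / p423698 (c312-1's `padicPresentationPr`).

HONEST SCOPE. Hull regions only (coordinate polydiscs); on non-product regions the two containers need not agree (they
are different averages of logarithms), and for `F` with real places the weights of (2) are not uniform (then (1) and
(2) differ by the weighting — `F` totally complex is print's standing assumption). `W = InfinitePlace F` here; a consumer
indexing the archimedean fibre by another type transports along its bijection with `InfinitePlace F`. Nothing here bears
on [IUTchIII] Cor. 3.12 or takes a side; typed ≠ endorsed. Classical (Lebesgue measure of polydiscs).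
[cite: Mochizuki2012, IUTchIV Prop. 1.5 (iii) p. 15]
-/

noncomputable section

namespace Literature.IUT.LogThetaLattice

open Literature.IUT.LogVolume Literature.IUT.LogVolume.Prop15iii Literature.IUT.LogVolume.ArchPacket NumberField
  MeasureTheory Set
open scoped ENNReal NNReal

variable (F : Type) [Field F] [NumberField F]
variable (A : Type) [Fintype A] [DecidableEq A] [Nonempty A]

/-- The sign patterns `{±}^{A ∖ {α₀}}` indexing the copies of `ℂ` in ONE portion `⊗_{α,ℝ} ℂ` (L5-t7 `Idx A Unit =
(A → Unit) × Signs A`). [cite: Mochizuki2012, IUTchIV Prop. 1.5 (iii) p. 15] -/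
abbrev Signs : Type := {i : A // i ≠ basePoint A} → Bool

/-! ### §1 The Remark 3.1.1 (ii) weights at `∞` are uniform for totally complex `F` -/

omit [NumberField F] in
/-- Every archimedean place of a totally complex field has `[F_w:ℝ] = 2`. [cite: NeukirchANT1999, Ch. III §1] -/
theorem mult_eq_two_of_isComplex (hc : ∀ w : InfinitePlace F, w.IsComplex) (w : InfinitePlace F) : w.mult = 2 :=
  InfinitePlace.mult_isComplex ⟨w, hc w⟩

/-- `[F:ℚ] = 2·#{w | ∞}` for totally complex `F`. [cite: NeukirchANT1999, Ch. III §1] -/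
theorem finrank_eq_two_mul_card_of_isComplex (hc : ∀ w : InfinitePlace F, w.IsComplex) :
    (Module.finrank ℚ F : ℝ) = 2 * Fintype.card (InfinitePlace F) := by
  have h := InfinitePlace.sum_mult_eq (K := F)
  simp_rw [mult_eq_two_of_isComplex F hc] at h
  rw [Finset.sum_const, Finset.card_univ, smul_eq_mul] at h
  rw [← h]
  push_cast
  ring

/-- The place weight `[F_w:ℝ]/[F:ℚ]` at an archimedean place of a totally complex `F` is `1/#{w | ∞}`.
[claim: Mochizuki2012, status: disputed] -/
theorem placeProbWeight_inl_of_isComplex (hc : ∀ w : InfinitePlace F, w.IsComplex) (w : InfinitePlace F) :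
    placeProbWeight F (Sum.inl w) = (Fintype.card (InfinitePlace F) : ℝ)⁻¹ := by
  have hW : (0 : ℝ) < Fintype.card (InfinitePlace F) := by exact_mod_cast Fintype.card_pos
  rw [placeProbWeight_inl, mult_eq_two_of_isComplex F hc, finrank_eq_two_mul_card_of_isComplex F hc]
  push_cast
  field_simp

omit [Nonempty A] in
/-- **The Remark 3.1.1 (ii) weights at `∞` are UNIFORM for totally complex `F`**: `portionWeight π = ∏_α
[F_{w_α}:ℝ]/[F:ℚ] = (#{w|∞})^{−|A|} = 1/#{portions}`. [claim: Mochizuki2012, status: disputed] -/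
theorem portionWeight_infty_of_isComplex (hc : ∀ w : InfinitePlace F, w.IsComplex) (π : Portion F A RatPlace.infty) :
    portionWeight F A RatPlace.infty π = ((Fintype.card (A → InfinitePlace F) : ℕ) : ℝ)⁻¹ := by
  have hfac : ∀ α, placeProbWeight F (π α).1 = (Fintype.card (InfinitePlace F) : ℝ)⁻¹ := by
    intro α
    generalize π α = v
    rcases v with ⟨w | w, h⟩
    · exact placeProbWeight_inl_of_isComplex F hc w
    · exact absurd h (ratPlaceBelow_inr_ne_infty F w)
  unfold portionWeight
  simp_rw [hfac]
  rw [Finset.prod_const, Finset.card_univ, Fintype.card_fun, Nat.cast_pow, inv_pow]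

/-! ### §2 Hull regions of ONE portion `⊗_{α,ℝ} ℂ` -/

section Portion

variable (wA : A → InfinitePlace F)

/-- **A hull region of the portion `⊗_{α,ℝ} ℂ`**: the polydisc with radius `s ε > 0` at the coordinate `ε ∈ {±}^{A∖{α₀}}`
of the canonical decomposition ([IUTchIII] Rmk. 3.9.5 (i) hull-sets; L5-t7 `polydisc`), as an admissible region of the
archimedean portion (positive finite Lebesgue volume). [claim: Mochizuki2012, status: disputed] -/
def archHullPortionRegion (s : Signs A → ℝ) (hs : ∀ ε, 0 < s ε) : (archPortion F A wA).Adm :=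
  ⟨(canonicalDecomposition A Unit : MI A Unit → (Idx A Unit → ℂ)) ⁻¹' polydisc (Idx A Unit) (fun idx => s idx.2), by
    have himg : (canonicalDecomposition A Unit : MI A Unit → (Idx A Unit → ℂ)) ''
        ((canonicalDecomposition A Unit : MI A Unit → (Idx A Unit → ℂ)) ⁻¹'
          polydisc (Idx A Unit) (fun idx => s idx.2)) = polydisc (Idx A Unit) (fun idx => s idx.2) :=
      Set.image_preimage_eq _ (canonicalDecomposition A Unit).surjective
    have h : volume ((canonicalDecomposition A Unit : MI A Unit → (Idx A Unit → ℂ)) ''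
        ((canonicalDecomposition A Unit : MI A Unit → (Idx A Unit → ℂ)) ⁻¹'
          polydisc (Idx A Unit) (fun idx => s idx.2))) ≠ 0 ∧
      volume ((canonicalDecomposition A Unit : MI A Unit → (Idx A Unit → ℂ)) ''
        ((canonicalDecomposition A Unit : MI A Unit → (Idx A Unit → ℂ)) ⁻¹'
          polydisc (Idx A Unit) (fun idx => s idx.2))) ≠ ⊤ := by
      rw [himg]
      exact ⟨(volume_polydisc_pos (Idx A Unit) fun idx => hs idx.2).ne', (volume_polydisc_lt_top (Idx A Unit) _).ne⟩
    exact h⟩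

omit [NumberField F] in
/-- Its coordinates ARE the polydisc. [claim: Mochizuki2012, status: disputed] -/
theorem image_archHullPortionRegion (s : Signs A → ℝ) (hs : ∀ ε, 0 < s ε) :
    (canonicalDecomposition A Unit : MI A Unit → (Idx A Unit → ℂ)) '' (archHullPortionRegion F A wA s hs).1 =
      polydisc (Idx A Unit) (fun idx => s idx.2) :=
  Set.image_preimage_eq _ (canonicalDecomposition A Unit).surjective

/-- Summing over the coordinates `Idx A Unit = (A → Unit) × {±}'` of one portion is summing over the sign patterns.
[cite: Mochizuki2012, IUTchIV Prop. 1.5 (iii) p. 15] -/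
theorem sum_idx_unit (g : Signs A → ℝ) : ∑ idx : Idx A Unit, g idx.2 = ∑ ε : Signs A, g ε := by
  rw [Fintype.sum_prod_type]
  simp

/-- `#Idx A Unit = #{±}'` (one portion has `2^{|A|−1}` copies of `ℂ`). [cite: Mochizuki2012, IUTchIV Prop. 1.5 (iii) p. 15] -/
theorem card_idx_unit : Fintype.card (Idx A Unit) = Fintype.card (Signs A) := by
  rw [Fintype.card_prod, Fintype.card_unique, one_mul]

omit [NumberField F] in
/-- **The portion log-volume of a hull region is the average of its log-radii**: `μ^log_π(⊕_ε s_ε·𝒪) =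
(1/#{±}')·Σ_ε log s_ε` (L5-t7 `nlogVol_polydisc`). [claim: Mochizuki2012, status: disputed] -/
theorem archPortion_logVol_archHullPortionRegion (s : Signs A → ℝ) (hs : ∀ ε, 0 < s ε) :
    (archPortion F A wA).logVol (archHullPortionRegion F A wA s hs).1 =
      (Fintype.card (Signs A) : ℝ)⁻¹ * ∑ ε : Signs A, Real.log (s ε) := by
  show packetLogVol (canonicalDecomposition A Unit) (archHullPortionRegion F A wA s hs).1 = _
  rw [packetLogVol, image_archHullPortionRegion, nlogVol_polydisc (Idx A Unit) (fun idx => hs idx.2), card_idx_unit,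
    sum_idx_unit A (fun ε => Real.log (s ε))]

end Portion

/-! ### §3 Hull regions of the single container `M_I = ⊗_{α,ℝ} (⊕_w ℂ_w)` -/

section Container

variable (W : Type) [Fintype W] [DecidableEq W]

/-- **A hull region of `M_I = ⊗_{α∈A,ℝ} (⊕_{w∈W} ℂ_w)`**: the polydisc with radius `r(π, ε) > 0` at the coordinate
`(π, ε) ∈ (A → W) × {±}^{A∖{α₀}}` of L5-t7's canonical decomposition `Φ₀ : M_I ≅ ⊕_{(π,ε)} ℂ` ([IUTchIV] Prop. 1.5 (iii);
[IUTchIII] Rmk. 3.9.5 hull-sets). [claim: Mochizuki2012, status: disputed] -/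
def archHullRegion (r : (A → W) → Signs A → ℝ) : Set (MI A W) :=
  (canonicalDecomposition A W : MI A W → (Idx A W → ℂ)) ⁻¹' polydisc (Idx A W) (fun idx => r idx.1 idx.2)

omit [DecidableEq W] in
/-- Its coordinates ARE the polydisc. [claim: Mochizuki2012, status: disputed] -/
theorem image_archHullRegion (r : (A → W) → Signs A → ℝ) :
    (canonicalDecomposition A W : MI A W → (Idx A W → ℂ)) '' archHullRegion A W r =
      polydisc (Idx A W) (fun idx => r idx.1 idx.2) :=
  Set.image_preimage_eq _ (canonicalDecomposition A W).surjective

omit [DecidableEq W] in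
/-- It has positive finite volume in the coordinates (admissible for c312's `ArchPresentation.adm`).
[claim: Mochizuki2012, status: disputed] -/
theorem volume_image_archHullRegion_pos_lt_top (r : (A → W) → Signs A → ℝ) (hr : ∀ π ε, 0 < r π ε) :
    0 < volume ((canonicalDecomposition A W : MI A W → (Idx A W → ℂ)) '' archHullRegion A W r) ∧
      volume ((canonicalDecomposition A W : MI A W → (Idx A W → ℂ)) '' archHullRegion A W r) < ⊤ := by
  rw [image_archHullRegion]
  exact ⟨volume_polydisc_pos (Idx A W) fun idx => hr idx.1 idx.2, volume_polydisc_lt_top (Idx A W) _⟩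

omit [DecidableEq W] in
/-- **The single-container log-volume of a hull region**: `μ^log_{M_I}(⊕_{(π,ε)} r(π,ε)·𝒪) = (1/#(A→W))·Σ_π
(1/#{±}')·Σ_ε log r(π,ε)` — the average over the PORTIONS of the portion averages (L5-t7 `nlogVol_polydisc` on
`Idx A W = (A → W) × {±}'`). [claim: Mochizuki2012, status: disputed] -/
theorem packetLogVol_archHullRegion [Nonempty W] (r : (A → W) → Signs A → ℝ) (hr : ∀ π ε, 0 < r π ε) :
    packetLogVol (canonicalDecomposition A W) (archHullRegion A W r) =
      ((Fintype.card (A → W) : ℕ) : ℝ)⁻¹ *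
        ∑ π : A → W, (Fintype.card (Signs A) : ℝ)⁻¹ * ∑ ε : Signs A, Real.log (r π ε) := by
  rw [packetLogVol, image_archHullRegion, nlogVol_polydisc (Idx A W) (fun idx => hr idx.1 idx.2), Fintype.card_prod,
    Fintype.sum_prod_type, ← Finset.mul_sum, Nat.cast_mul, mul_inv, mul_assoc]

end Container

/-! ### §4 The junction: genuine capsule `μ^log_{A,∞}` = single-container `μ^log_{M_I}` on hull families -/

/-- **The hull family of the genuine capsule model** determined by the radii `r`: in the portion `π = (w_α)_α` the
polydisc with radii `r(π, ·)`. [claim: Mochizuki2012, status: disputed] -/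
def archHullFamily (r : (A → InfinitePlace F) → Signs A → ℝ) (hr : ∀ π ε, 0 < r π ε) :
    ∀ π : Portion F A RatPlace.infty, (portionDatum F A RatPlace.infty π).Adm :=
  fun π => archHullPortionRegion F A (fun β => packetInftyEquiv F (π β)) (r fun β => packetInftyEquiv F (π β))
    (hr fun β => packetInftyEquiv F (π β))

/-- The portions `A → 𝕍(F)_∞` of the model are the tuples `A → {w | ∞}` (along `packetInftyEquiv`).
[claim: Mochizuki2012, status: disputed] -/
def portionInftyEquiv : Portion F A RatPlace.infty ≃ (A → InfinitePlace F) :=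
  Equiv.piCongrRight fun _ => packetInftyEquiv F

omit [NumberField F] [Fintype A] [DecidableEq A] [Nonempty A] in
/-- Unfolding `portionInftyEquiv`. [claim: Mochizuki2012, status: disputed] -/
@[simp] theorem portionInftyEquiv_apply (π : Portion F A RatPlace.infty) (β : A) :
    portionInftyEquiv F A π β = packetInftyEquiv F (π β) := rfl

/-- **THE ARCHIMEDEAN JUNCTION ON HULL-SETS (totally complex `F`).** The genuine capsule log-volume `μ^log_{A,∞}` of the
hull family with radii `r` (p419250's `capsulePacketLogVolume`: portions `⊗_{α,ℝ}ℂ` averaged with the Remark 3.1.1 (ii)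
weights) EQUALS the single-container log-volume of the hull region with the same radii in [IUTchIV] Prop. 1.5 (iii)'s
`M_I = ⊗_{α,ℝ}(⊕_{w|∞} ℂ_w)` (L5-t7 `packetLogVol`, the Cor 3.12 crew's archimedean `logμ`): both are
`(1/#(A→W))·Σ_π (1/#{±}')·Σ_ε log r(π,ε)` — the weights of (ii) are uniform because every `w | ∞` is complex
([IUTchI] Def. 3.1 (a)). [claim: Mochizuki2012, status: disputed] -/
theorem capsulePacketLogVolume_infty_archHullFamily (hc : ∀ w : InfinitePlace F, w.IsComplex)
    (r : (A → InfinitePlace F) → Signs A → ℝ) (hr : ∀ π ε, 0 < r π ε) :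
    capsulePacketLogVolume F A RatPlace.infty (archHullFamily F A r hr) =
      packetLogVol (canonicalDecomposition A (InfinitePlace F)) (archHullRegion A (InfinitePlace F) r) := by
  haveI : Nonempty (InfinitePlace F) := inferInstance
  rw [packetLogVol_archHullRegion A (InfinitePlace F) r hr]
  unfold capsulePacketLogVolume
  have hterm : ∀ π : Portion F A RatPlace.infty,
      portionWeight F A RatPlace.infty π * (portionDatum F A RatPlace.infty π).logVol (archHullFamily F A r hr π).1 =
        ((Fintype.card (A → InfinitePlace F) : ℕ) : ℝ)⁻¹ *
          ((Fintype.card (Signs A) : ℝ)⁻¹ * ∑ ε : Signs A, Real.log (r (portionInftyEquiv F A π) ε)) := by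
    intro π
    rw [portionWeight_infty_of_isComplex F A hc π]
    congr 1
    exact archPortion_logVol_archHullPortionRegion F A (fun β => packetInftyEquiv F (π β))
      (r fun β => packetInftyEquiv F (π β)) (hr fun β => packetInftyEquiv F (π β))
  simp_rw [hterm]
  rw [← Finset.mul_sum]
  congr 1
  exact (portionInftyEquiv F A).sum_comp
    (fun π' : A → InfinitePlace F => (Fintype.card (Signs A) : ℝ)⁻¹ * ∑ ε : Signs A, Real.log (r π' ε))

/-! ### §5 The junction for an arbitrary indexing of the archimedean fibre (the Cor 3.12 crew's `T.Fibre ∞`) -/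

section OfEquiv

variable {W : Type} [Fintype W]

/-- **The hull family read through a re-indexing of the portions**: for ANY finite type `W` indexing the archimedean
places through a bijection `e : (A → 𝕍(F)_∞) ≃ (A → W)` of portion sets (e.g. abc-iut-c312-1's `T.Fibre (inl ())` for
the real `thetaIndex`), the capsule hull family with radii `r ∘ e`. [claim: Mochizuki2012, status: disputed] -/
def archHullFamilyOfEquiv (e : Portion F A RatPlace.infty ≃ (A → W)) (r : (A → W) → Signs A → ℝ)
    (hr : ∀ π ε, 0 < r π ε) : ∀ π : Portion F A RatPlace.infty, (portionDatum F A RatPlace.infty π).Adm :=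
  fun π => archHullPortionRegion F A (fun β => packetInftyEquiv F (π β)) (r (e π)) (hr (e π))

/-- **THE ARCHIMEDEAN JUNCTION ON HULL-SETS, ANY INDEXING (totally complex `F`).** For every finite `W` and every
bijection `e` of the portion sets, the genuine capsule log-volume of the hull family `r ∘ e` equals the
single-container log-volume of the hull region with radii `r` in `M_I = ⊗_{α,ℝ}(⊕_{w∈W} ℂ_w)` — the form consumable by
the Cor 3.12 crew's `ArchPresentation.logμ vQ j = packetLogVol (canonicalDecomposition (T.Caps j) (T.Fibre vQ))` with
`A := T.Caps j`, `W := T.Fibre (inl ())`. [claim: Mochizuki2012, status: disputed] -/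
theorem capsulePacketLogVolume_infty_archHullFamilyOfEquiv [Nonempty W] (hc : ∀ w : InfinitePlace F, w.IsComplex)
    (e : Portion F A RatPlace.infty ≃ (A → W)) (r : (A → W) → Signs A → ℝ) (hr : ∀ π ε, 0 < r π ε) :
    capsulePacketLogVolume F A RatPlace.infty (archHullFamilyOfEquiv F A e r hr) =
      packetLogVol (canonicalDecomposition A W) (archHullRegion A W r) := by
  rw [packetLogVol_archHullRegion A W r hr]
  unfold capsulePacketLogVolume
  have hcard : Fintype.card (A → InfinitePlace F) = Fintype.card (A → W) :=
    (Fintype.card_congr (portionInftyEquiv F A)).symm.trans (Fintype.card_congr e)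
  have hterm : ∀ π : Portion F A RatPlace.infty,
      portionWeight F A RatPlace.infty π *
          (portionDatum F A RatPlace.infty π).logVol (archHullFamilyOfEquiv F A e r hr π).1 =
        ((Fintype.card (A → W) : ℕ) : ℝ)⁻¹ *
          ((Fintype.card (Signs A) : ℝ)⁻¹ * ∑ ε : Signs A, Real.log (r (e π) ε)) := by
    intro π
    rw [portionWeight_infty_of_isComplex F A hc π, hcard]
    congr 1
    exact archPortion_logVol_archHullPortionRegion F A (fun β => packetInftyEquiv F (π β)) (r (e π)) (hr (e π))
  simp_rw [hterm]
  rw [← Finset.mul_sum]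
  congr 1
  exact e.sum_comp (fun π' : A → W => (Fintype.card (Signs A) : ℝ)⁻¹ * ∑ ε : Signs A, Real.log (r π' ε))

end OfEquiv

end Literature.IUT.LogThetaLattice

end
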